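/-
Copyright (c) 2026 the pub-hodgecm-mathlib formalisation cell (harness21).  Prover seat hodgecm-mathlib-F0P3-p03 (g15): road «S3-ram» (LEAD F0P3a-plan (g12); architect
A-p16 (g31) deal 23:19:27Z «G7 → F0P3-p03»; owner F0P3a-p06 (g15)), organ A′ (ii) (a2), gap G7 (C3) «THE RANK-ONE CLASS LOCK `s_b = s₀κ_b`»; 2026-09-01.
-/
import Literature.NumberTheory.Automorphic.UnitaryLatticeTreeBlockLineStableRoot   -- ★ p847252 (F0P3a-p07 (g13)): `pairing_single_{left,right}_of_block`; brings ★ p847183 (the diagonal split root)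
import HarnessLib

/-!
# The lattice graph of a hermitian space — THE CLASS LOCK AT A SPLIT VERTEX: when `γ − 1` is residually a scalar `c·ϖ^d` on the plane part and `cᵢ·ϖ^d` on the isolated
# line of a self-dual `M = 𝒪e_i ⊕ (M ∩ W_i)`, the depth-`d` value `ϖ^{−d}⟨x, (γ−1)x⟩` at EVERY residually isotropic `x ∈ M` is `(cᵢ − c)·H_{ii}·x_i²` to first order
# (Bruhat–Tits 1972 §10; Kottwitz 1986 §3; Rogawski 1990 §4.9)

Topic `NumberTheory/Automorphic`; namespace `Literature.NumberTheory.Automorphic.UnitaryLatticeTree`.  THEOREMS ONLY (no definition, no instance, no notation, no named fact,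
no `sorry`); kernel lane `--supports stmt-HodgeConjecture-24833`; datum-free (`K` with `Valued K ℤᵐ⁰`; §2–§4 use ONLY `σ` residually trivial on `𝒪` — the tame-ramified token
`hres` of ★ `UnitaryLatticeTreeFixedChildClassRamified` — and `|ϖ| < 1`).  Cell `pub/hodgecm-mathlib` (D-0151), crux H413; road «S3-ram» (Literature seeding, count-neutral),
P-1-ram organ A′ (ii) (a2) «SHELL SUMS», gap **G7 (C3) «RANK-1 CLASS LOCK»** of `F0/P3a/F0P3a-p01/g16/rootbook/BLUEPRINT-a2B-TreeInduction.v1…md` §3 and of the design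
`…/DESIGN-a2C-RootBookkeeping.v1…md` §2–§3: at a vertex `M` of the ROOT REGION ∕ AXIS of an ISOCELES literal (★ p847183 `…IsolatedIndexStableRoot`: `M = 𝒪e_u ⊕ M′`, the
torus element acting on `M′ ∕ ϖM′` as the residual scalar `2Ā` and on `e_u` as `0`), every fixed child through an isotropic residual line `x̄` with `x̄_u ≠ 0` is rank one of ONE
AND THE SAME square class `class(−Q_Ȳ(x̄)) = class(2Ā·d̄_u)` — and since `d̄_u = ε^{b_u}·d̄⁰_u` across the four literals `b`, the class is LOCKED TO THE κ-SIGN: `s_b = s₀·κ_b`,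
`κ_b = (−1)^{b_u}` (the mechanism behind the collar columns of A-p16 (g31)'s certificate CERT-P1ram-T0).  Stated for a form `H` BLOCK at `i` (`H_{li} = H_{il} = 0`, `l ≠ i`) —
so it serves the DIAGONAL model of the type-(1) literals (★ p847183, ★ p847156, ★ p847132) and the BLOCK model of type (2) (★ p847252, F0P3a-p07 (g13): «type (2) = isoceles with
an elliptic axis») alike — and for an arbitrary matrix `Y` (the `γ − 1`), with the two residues `c` (plane) and `cᵢ` (line) free, so that EITHER normalisation of the literal
(TOKENS d81ac9e9: divide by the eigenvalue `α`, zero residue on the line `e_α`; DESIGN §2: translate `y_u = 0`, zero residue on `e_u`) instantiates it: only the DIFFERENCE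
`cᵢ − c` = the residue of `ϖ^{−d}(λ_i − λ_j)` enters, as it must.

THE MATHEMATICS.  Let `H` be block at `i` with `|H_{ii}| ≤ 1`, `M ⊆ K³` an `𝒪`-module on which the form is integral (`M ≤ M^♯`) with `e_i ∈ M` and `|x_i| ≤ 1` on `M` (the
splitting `M = 𝒪e_i ⊕ (M ∩ W_i)` of ★ p847183 ∕ ★ p847252 §2–§3), and let `Y` satisfy, for some `d` and integral `c, cᵢ`:
  (W) `Y x′ ≡ c·ϖ^d·x′ (mod ϖ^{d+1}M)` for `x′ ∈ M ∩ W_i`   and   (L) `Y e_i ≡ cᵢ·ϖ^d·e_i (mod ϖ^{d+1}M)`.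
For `x = x_i e_i + x′ ∈ M`: `⟨x, Yx⟩ = c ϖ^d⟨x, x′⟩ + cᵢ ϖ^d x_i⟨x, e_i⟩ + ϖ^{d+1}·(integral)`, and since `e_i ⊥ W_i`: `⟨x, e_i⟩ = σ(x_i)H_{ii}`, `⟨x, x′⟩ = ⟨x′, x′⟩ =
⟨x, x⟩ − σ(x_i)H_{ii}x_i` (§1).  Hence **`ϖ^{−d}⟨x, Yx⟩ = (cᵢ − c)·H_{ii}·σ(x_i)x_i + c·⟨x, x⟩ + ϖ·(integral)`**, and if `x̄` is ISOTROPIC (`|⟨x,x⟩| < 1`) and `σ` is residually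
trivial (`σ(x_i)x_i ≡ x_i²`): **`|ϖ^{−d}⟨x, Yx⟩ − (cᵢ − c)·H_{ii}·x_i²| < 1`** (§2 `v_pairing_mulVec_sub_mul_sq_lt_of_block`).  Consequences (§3): at a line with `|x_i| = 1` the
value `−ϖ^{−d}⟨x, Yx⟩` — whose class is the square class of the child through `x̄`, ★ `v_B₀_conj_add_sq_mul_B₀_lt` (F0P2-p01 (g15), FILE F) — lies in the class of the CONSTANT
`(c − cᵢ)·H_{ii}` (`v_neg_pairing_mulVec_sub_mul_sq_lt_of_block`: the TOKENS `CLS` shape `∃ a, |a| = 1 ∧ |value − w·a²| < 1` with `a = x_i`), and NOT in the other class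
`(c − cᵢ)·H_{ii}·ε`, `ε` a residue non-square (`not_v_sub_mul_sq_lt_and_v_sub_mul_mul_sq_lt`, `…_of_block`) — ONE class for ALL such lines: the lock; at a line with `|x_i| < 1`
(an isotropic point of the plane part `M̄′` — the `ν(L) ∈ {0, 2}` axis directions of DESIGN §2) the value is in `𝔪` (§4 `v_pairing_mulVec_lt_one_of_block`: the corner passes, the
child starts an `E∕O`-chain).  §5 is the bookkeeping across the literal family: if the line entry of the form is twisted by `ε` (`H′_{ii} = ε·H_{ii}`, the `b_u = 1` literals) the
constant is twisted by `ε`: `s_b = s₀·κ_b` (`v_neg_pairing_mulVec_sub_mul_mul_sq_lt_of_block`).  §6 specialises (W)(L) to the DIAGONAL model of ★ p847183: `H = diag(h)`,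
`Y = ϖ^d·diag(s)` with the two plane residues congruent (`|s_j − s_{j′}| < 1`) — there (L) holds with `cᵢ = s_i` exactly and (W) holds with `c = s_{j′}` as soon as
`ϖ⁻¹(s_j − s_{j′})·x_j·e_j ∈ M` for `x ∈ M ∩ W_i` (the INTERIOR of the binary fixed ball: `v_pairing_diagonal_mulVec_sub_mul_sq_lt_of_interior`).
HONEST LABEL: HC_CM is proved only modulo the 2 remaining named inputs (hLiu418 24832, h413 24833) until rung 0 closes; nothing printed is asserted here (elementary lattice
algebra over a valuation ring); «S3-ram» has no books consequence.

* §1 `pairing_self_eq_of_block`, `pairing_self_sub_single_eq_of_block` (the split of `⟨x, x⟩` along `e_i ⊥ W_i`).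
* §2 `pairing_mulVec_eq_of_block` (the exact first-order identity), **`v_pairing_mulVec_sub_mul_sq_lt_of_block`** (THE CLASS LOCK).
* §3 `v_neg_pairing_mulVec_sub_mul_sq_lt_of_block` (CLS shape), `not_v_sub_mul_sq_lt_and_v_sub_mul_mul_sq_lt` (two classes are disjoint), `not_v_neg_pairing_mulVec_sub_mul_mul_sq_lt_of_block`.
* §4 `v_pairing_mulVec_lt_one_of_block` (axis directions: the value vanishes residually).
* §5 `v_neg_pairing_mulVec_sub_mul_mul_sq_lt_of_block` (the `ε`-twisted literal: the constant twists by `ε`).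
* §6 `v_pairing_diagonal_mulVec_sub_mul_sq_lt_of_interior` (diagonal model, interior axis vertex).

## References
* [BruhatTits1972] F. Bruhat, J. Tits, *Groupes réductifs sur un corps local I*, Publ. Math. IHÉS 41 (1972), §10 (lattices adapted to a partial eigen-decomposition; filtrations).
* [Kottwitz1986] R. E. Kottwitz, *Base change for unit elements of Hecke algebras*, Compositio Math. 60 (1986), §3 (fixed lattices as `𝒪[γ]`-modules; levels; Levi blocks).
* [Rogawski1990] J. D. Rogawski, *Automorphic Representations of Unitary Groups in Three Variables*, Ann. of Math. Stud. 123 (1990), §4.9 pp. 54–56 (strata of the ramified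
  orbital integrals by the residual quadratic form).
* [Serre1980Trees] J.-P. Serre, *Trees* (1980), Ch. II §1.1.
-/

set_option autoImplicit false

noncomputable section

open scoped Valued WithZero Matrix MatrixGroups

namespace Literature.NumberTheory.Automorphic.UnitaryLatticeTree

open Literature.NumberTheory.Automorphic Literature.NumberTheory.Automorphic.HermitianLattice

variable {K : Type*} [Field K] [Valued K ℤᵐ⁰]

/-! ## §1 The split of `⟨x, x⟩` along `e_i ⊥ W_i` -/

omit [Valued K ℤᵐ⁰] in
/-- For a form BLOCK at `i`: `⟨x, x⟩ = σ(x_i)·H_{ii}·x_i + ⟨x′, x′⟩` with `x′ = x − x_i e_i` (the cross terms vanish: `e_i ⊥ W_i`). [cite: BruhatTits1972, §10] -/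
theorem pairing_self_eq_of_block {N : ℕ} (σ : K →+* K) (H : Matrix (Fin N) (Fin N) K) (i : Fin N)
    (hHcol : ∀ l, l ≠ i → H l i = 0) (hHrow : ∀ l, l ≠ i → H i l = 0) (x : Fin N → K) :
    pairing σ H x x = σ (x i) * H i i * x i + pairing σ H (x - Pi.single i (x i)) (x - Pi.single i (x i)) := by
  have hx'i : (x - Pi.single i (x i) : Fin N → K) i = 0 := by simp
  have e : x = (x - Pi.single i (x i)) + Pi.single i (x i) := (sub_add_cancel _ _).symm
  conv_lhs => rw [e]
  rw [LinearMap.map_add₂, map_add, map_add, pairing_single_right_of_block σ H i hHcol, hx'i, map_zero, zero_mul, zero_mul, add_zero,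
    pairing_single_left_of_block σ H i hHrow, hx'i, mul_zero, zero_add, pairing_single_left_of_block σ H i hHrow, Pi.single_eq_same]
  ring

omit [Valued K ℤᵐ⁰] in
/-- For a form BLOCK at `i`: `⟨x, x − x_i e_i⟩ = ⟨x, x⟩ − σ(x_i)·H_{ii}·x_i` (`= ⟨x′, x′⟩`). [cite: BruhatTits1972, §10] -/
theorem pairing_self_sub_single_eq_of_block {N : ℕ} (σ : K →+* K) (H : Matrix (Fin N) (Fin N) K) (i : Fin N)
    (hHcol : ∀ l, l ≠ i → H l i = 0) (x : Fin N → K) :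
    pairing σ H x (x - Pi.single i (x i)) = pairing σ H x x - σ (x i) * H i i * x i := by
  rw [map_sub, pairing_single_right_of_block σ H i hHcol]

/-! ## §2 The class lock -/

omit [Valued K ℤᵐ⁰] in
/-- **THE FIRST-ORDER IDENTITY.**  If `Y x′ = c ϖ^d x′ + ϖ^{d+1} m₂` (`x′ = x − x_i e_i`) and `Y e_i = cᵢ ϖ^d e_i + ϖ^{d+1} m₁`, then for a form block at `i`:
`⟨x, Yx⟩ = ϖ^d·((cᵢ − c)·H_{ii}·σ(x_i)x_i + c·⟨x, x⟩) + ϖ^{d+1}·(⟨x, m₂⟩ + x_i·⟨x, m₁⟩)` (pure algebra). [cite: Kottwitz1986, §3] [cite: BruhatTits1972, §10] -/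
theorem pairing_mulVec_eq_of_block (σ : K →+* K) (H : Matrix (Fin 3) (Fin 3) K) (i : Fin 3) (hHcol : ∀ l, l ≠ i → H l i = 0)
    (Y : Matrix (Fin 3) (Fin 3) K) (ϖ c cᵢ : K) (d : ℕ) {x m₁ m₂ : Fin 3 → K}
    (hW : Y *ᵥ (x - Pi.single i (x i)) = (c * ϖ ^ d) • (x - Pi.single i (x i)) + ϖ ^ (d + 1) • m₂)
    (hL : Y *ᵥ Pi.single i (1 : K) = (cᵢ * ϖ ^ d) • Pi.single i (1 : K) + ϖ ^ (d + 1) • m₁) :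
    pairing σ H x (Y *ᵥ x) = ϖ ^ d * ((cᵢ - c) * H i i * (σ (x i) * x i) + c * pairing σ H x x) +
      ϖ ^ (d + 1) * (pairing σ H x m₂ + x i * pairing σ H x m₁) := by
  have hsingle : (Pi.single i (x i) : Fin 3 → K) = x i • (Pi.single i (1 : K) : Fin 3 → K) := by
    ext l; by_cases hl : l = i
    · subst hl; simp
    · simp [Pi.single_eq_of_ne hl]
  have e : x = (x - Pi.single i (x i)) + x i • (Pi.single i (1 : K) : Fin 3 → K) := by rw [← hsingle, sub_add_cancel]
  have hYx : Y *ᵥ x = ((c * ϖ ^ d) • (x - Pi.single i (x i)) + ϖ ^ (d + 1) • m₂) + x i • ((cᵢ * ϖ ^ d) • Pi.single i (1 : K) + ϖ ^ (d + 1) • m₁) := by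
    conv_lhs => rw [e]
    rw [Matrix.mulVec_add, Matrix.mulVec_smul, hW, hL]
  rw [hYx, map_add, map_add, map_smul, map_smul, map_smul, map_add, map_smul, map_smul, pairing_self_sub_single_eq_of_block σ H i hHcol,
    pairing_single_right_of_block σ H i hHcol]
  simp only [smul_eq_mul]
  ring

/-- **THE CLASS LOCK AT A SPLIT VERTEX.**  Let `H` be block at `i` with `|H_{ii}| ≤ 1`, `σ` residually trivial on `𝒪` (`hres`), `|ϖ| < 1`; `M` an `𝒪`-module on which the
form is integral (`M ≤ M^♯`), containing `e_i`, with `|x_i| ≤ 1` on `M` (★ `…_single_mem_of_block` ∕ `…_of_isolated`); and `Y` (the `γ − 1`) with, for integral `c, cᵢ` and a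
depth `d`: (W) `ϖ^{−(d+1)}·(Y x′ − cϖ^d x′) ∈ M` for `x′ ∈ M ∩ W_i`, (L) `ϖ^{−(d+1)}·(Y e_i − cᵢϖ^d e_i) ∈ M`.  Then for every `x ∈ M` with `x̄` ISOTROPIC (`|⟨x, x⟩| < 1`):
**`|ϖ^{−d}⟨x, Yx⟩ − (cᵢ − c)·H_{ii}·x_i²| < 1`** — the depth-`d` value of `⟨·, (γ−1)·⟩` along EVERY such line is `(cᵢ − c)H_{ii}·x_i²`; its class does not depend on the line.
[cite: Kottwitz1986, §3] [cite: Rogawski1990, §4.9 pp. 54–56] [cite: BruhatTits1972, §10] -/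
theorem v_pairing_mulVec_sub_mul_sq_lt_of_block {σ : K →+* K} (hres : ∀ z : K, Valued.v z ≤ 1 → Valued.v (σ z - z) < 1)
    {ϖ : K} (hϖ : Valued.v ϖ < 1) (hϖ0 : ϖ ≠ 0) {H : Matrix (Fin 3) (Fin 3) K} (i : Fin 3) (hHcol : ∀ l, l ≠ i → H l i = 0) (hHii : Valued.v (H i i) ≤ 1)
    {M : Submodule 𝒪[K] (Fin 3 → K)} (hMd : M ≤ dualLatt σ H M) (he : (Pi.single i (1 : K) : Fin 3 → K) ∈ M) (hcoord : ∀ x ∈ M, Valued.v (x i) ≤ 1)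
    (Y : Matrix (Fin 3) (Fin 3) K) {c cᵢ : K} (hc : Valued.v c ≤ 1) (hcᵢ : Valued.v cᵢ ≤ 1) (d : ℕ)
    (hYW : ∀ x ∈ M, x i = 0 → (ϖ ^ (d + 1))⁻¹ • (Y *ᵥ x - (c * ϖ ^ d) • x) ∈ M)
    (hYL : (ϖ ^ (d + 1))⁻¹ • (Y *ᵥ Pi.single i (1 : K) - (cᵢ * ϖ ^ d) • Pi.single i (1 : K)) ∈ M)
    {x : Fin 3 → K} (hx : x ∈ M) (hiso : Valued.v (pairing σ H x x) < 1) :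
    Valued.v ((ϖ ^ d)⁻¹ * pairing σ H x (Y *ᵥ x) - (cᵢ - c) * H i i * x i ^ 2) < 1 := by
  have hϖd0 : ϖ ^ d ≠ 0 := pow_ne_zero _ hϖ0
  have hϖd1 : ϖ ^ (d + 1) ≠ 0 := pow_ne_zero _ hϖ0
  -- the split `x = x_i e_i + x′`, `x′ ∈ M ∩ W_i`
  have hsingle : (Pi.single i (x i) : Fin 3 → K) = (⟨x i, (mem_integer_iff' _).2 (hcoord x hx)⟩ : 𝒪[K]) • (Pi.single i (1 : K) : Fin 3 → K) := by
    ext l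
    change (Pi.single i (x i) : Fin 3 → K) l = x i * (Pi.single i (1 : K) : Fin 3 → K) l
    by_cases hl : l = i
    · subst hl; simp
    · simp [Pi.single_eq_of_ne hl]
  have hx' : x - Pi.single i (x i) ∈ M := M.sub_mem hx (by rw [hsingle]; exact M.smul_mem _ he)
  have hx'i : (x - Pi.single i (x i) : Fin 3 → K) i = 0 := by simp
  -- name the two error vectors
  set m₂ := (ϖ ^ (d + 1))⁻¹ • (Y *ᵥ (x - Pi.single i (x i)) - (c * ϖ ^ d) • (x - Pi.single i (x i))) with hm₂
  set m₁ := (ϖ ^ (d + 1))⁻¹ • (Y *ᵥ Pi.single i (1 : K) - (cᵢ * ϖ ^ d) • Pi.single i (1 : K)) with hm₁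
  have hm₂M : m₂ ∈ M := hYW _ hx' hx'i
  have hm₁M : m₁ ∈ M := hYL
  have hW : Y *ᵥ (x - Pi.single i (x i)) = (c * ϖ ^ d) • (x - Pi.single i (x i)) + ϖ ^ (d + 1) • m₂ := by
    rw [hm₂, smul_smul, mul_inv_cancel₀ hϖd1, one_smul, add_sub_cancel]
  have hL : Y *ᵥ Pi.single i (1 : K) = (cᵢ * ϖ ^ d) • Pi.single i (1 : K) + ϖ ^ (d + 1) • m₁ := by
    rw [hm₁, smul_smul, mul_inv_cancel₀ hϖd1, one_smul, add_sub_cancel]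
  -- the first-order identity, divided by `ϖ^d`
  have hkey : (ϖ ^ d)⁻¹ * pairing σ H x (Y *ᵥ x) - (cᵢ - c) * H i i * x i ^ 2 =
      (cᵢ - c) * H i i * x i * (σ (x i) - x i) + c * pairing σ H x x + ϖ * (pairing σ H x m₂ + x i * pairing σ H x m₁) := by
    rw [pairing_mulVec_eq_of_block σ H i hHcol Y ϖ c cᵢ d hW hL, pow_succ]
    field_simp
    ring
  rw [hkey]
  -- three terms, each of valuation `< 1`
  have hxi := hcoord x hx
  have hcc : Valued.v (cᵢ - c) ≤ 1 := (Valuation.map_sub _ _ _).trans (max_le hcᵢ hc)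
  have h1 : Valued.v ((cᵢ - c) * H i i * x i * (σ (x i) - x i)) < 1 := by
    rw [map_mul, map_mul, map_mul]
    exact (mul_le_of_le_one_left' (mul_le_one' (mul_le_one' hcc hHii) hxi)).trans_lt (hres _ hxi)
  have h2 : Valued.v (c * pairing σ H x x) < 1 := by
    rw [map_mul]; exact (mul_le_of_le_one_left' hc).trans_lt hiso
  have h3 : Valued.v (ϖ * (pairing σ H x m₂ + x i * pairing σ H x m₁)) < 1 := by
    have hint : Valued.v (pairing σ H x m₂ + x i * pairing σ H x m₁) ≤ 1 := by
      refine (Valuation.map_add _ _ _).trans (max_le ?_ ?_)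
      · exact (mem_dualLatt σ H M _).1 (hMd hm₂M) x hx
      · rw [map_mul]; exact mul_le_one' hxi ((mem_dualLatt σ H M _).1 (hMd hm₁M) x hx)
    rw [map_mul]
    exact (mul_le_of_le_one_right' hint).trans_lt hϖ
  exact Valuation.map_add_lt _ (Valuation.map_add_lt _ h1 h2) h3

/-! ## §3 The class of `−ϖ^{−d}⟨x, Yx⟩`: one class along every line off the plane, and not the other -/

/-- **CLS SHAPE.**  Under the hypotheses of the class lock, at a line with `|x_i| = 1` (the residual point `x̄` is OFF the plane `M̄′`): `∃ a, |a| = 1 ∧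
|−ϖ^{−d}⟨x, Yx⟩ − ((c − cᵢ)·H_{ii})·a²| < 1` (`a = x_i`) — the TOKENS `CLS` shape for the constant `w = (c − cᵢ)H_{ii}`, the same for every such line; by ★
`v_B₀_conj_add_sq_mul_B₀_lt` (FILE F) this is the square class of the fixed child through `x̄`. [cite: Kottwitz1986, §3] [cite: Rogawski1990, §4.9 pp. 54–56] -/
theorem v_neg_pairing_mulVec_sub_mul_sq_lt_of_block {σ : K →+* K} (hres : ∀ z : K, Valued.v z ≤ 1 → Valued.v (σ z - z) < 1)
    {ϖ : K} (hϖ : Valued.v ϖ < 1) (hϖ0 : ϖ ≠ 0) {H : Matrix (Fin 3) (Fin 3) K} (i : Fin 3) (hHcol : ∀ l, l ≠ i → H l i = 0) (hHii : Valued.v (H i i) ≤ 1)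
    {M : Submodule 𝒪[K] (Fin 3 → K)} (hMd : M ≤ dualLatt σ H M) (he : (Pi.single i (1 : K) : Fin 3 → K) ∈ M) (hcoord : ∀ x ∈ M, Valued.v (x i) ≤ 1)
    (Y : Matrix (Fin 3) (Fin 3) K) {c cᵢ : K} (hc : Valued.v c ≤ 1) (hcᵢ : Valued.v cᵢ ≤ 1) (d : ℕ)
    (hYW : ∀ x ∈ M, x i = 0 → (ϖ ^ (d + 1))⁻¹ • (Y *ᵥ x - (c * ϖ ^ d) • x) ∈ M)
    (hYL : (ϖ ^ (d + 1))⁻¹ • (Y *ᵥ Pi.single i (1 : K) - (cᵢ * ϖ ^ d) • Pi.single i (1 : K)) ∈ M)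
    {x : Fin 3 → K} (hx : x ∈ M) (hiso : Valued.v (pairing σ H x x) < 1) (hxi : Valued.v (x i) = 1) :
    ∃ a : K, Valued.v a = 1 ∧ Valued.v (-((ϖ ^ d)⁻¹ * pairing σ H x (Y *ᵥ x)) - (c - cᵢ) * H i i * a ^ 2) < 1 := by
  refine ⟨x i, hxi, ?_⟩
  have h := v_pairing_mulVec_sub_mul_sq_lt_of_block hres hϖ hϖ0 i hHcol hHii hMd he hcoord Y hc hcᵢ d hYW hYL hx hiso
  rw [← Valuation.map_neg] at h
  convert h using 2
  ring

omit [Valued K ℤᵐ⁰] in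
/-- Two values congruent to unit squares times `w` and `w·ε` respectively cannot be congruent unless `ε` is residually a square: the algebra.
[cite: Rogawski1990, §4.9 pp. 54–56] -/
private theorem sub_mul_sq_identity (Q w ε a b : K) (hb : b ≠ 0) :
    w * b ^ 2 * ((a / b) ^ 2 - ε) = (Q - w * ε * b ^ 2) - (Q - w * a ^ 2) := by
  field_simp
  ring

/-- **THE TWO CLASSES ARE DISJOINT.**  If `w` is a unit and `ε` is a residue NON-square (`|z² − ε| = 1` for all integral `z`), no `Q` satisfies both `|Q − w·a²| < 1` and
`|Q − w·ε·b²| < 1` with units `a, b`. [cite: Rogawski1990, §4.9 pp. 54–56] [cite: Serre1980Trees, II.1.1] -/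
theorem not_v_sub_mul_sq_lt_and_v_sub_mul_mul_sq_lt {ε : K} (hε : ∀ z : K, Valued.v z ≤ 1 → Valued.v (z ^ 2 - ε) = 1)
    {w : K} (hw : Valued.v w = 1) (Q : K) {a b : K} (ha : Valued.v a = 1) (hb : Valued.v b = 1)
    (h₁ : Valued.v (Q - w * a ^ 2) < 1) (h₂ : Valued.v (Q - w * ε * b ^ 2) < 1) : False := by
  have hb0 : b ≠ 0 := fun h0 => by rw [h0, map_zero] at hb; exact zero_ne_one hb
  have hab : Valued.v (a / b) ≤ 1 := by rw [map_div₀, ha, hb, div_one]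
  have hlt : Valued.v (w * b ^ 2 * ((a / b) ^ 2 - ε)) < 1 := by
    rw [sub_mul_sq_identity Q w ε a b hb0]
    exact Valuation.map_sub_lt _ h₂ h₁
  rw [map_mul, map_mul, map_pow, hw, hb, one_pow, one_mul, one_mul, hε _ hab] at hlt
  exact lt_irrefl _ hlt

/-- **THE LOCK EXCLUDES THE OTHER CLASS.**  Under the hypotheses of the class lock with `(c − cᵢ)·H_{ii}` a UNIT (the two residues differ and `|H_{ii}| = 1`) and `ε` a residue
non-square: at a line with `|x_i| = 1` the value `−ϖ^{−d}⟨x, Yx⟩` is NOT in the class of `(c − cᵢ)·H_{ii}·ε` — no fixed child off the plane has the other class.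
[cite: Kottwitz1986, §3] [cite: Rogawski1990, §4.9 pp. 54–56] -/
theorem not_v_neg_pairing_mulVec_sub_mul_mul_sq_lt_of_block {σ : K →+* K} (hres : ∀ z : K, Valued.v z ≤ 1 → Valued.v (σ z - z) < 1)
    {ϖ : K} (hϖ : Valued.v ϖ < 1) (hϖ0 : ϖ ≠ 0) {H : Matrix (Fin 3) (Fin 3) K} (i : Fin 3) (hHcol : ∀ l, l ≠ i → H l i = 0) (hHii : Valued.v (H i i) ≤ 1)
    {M : Submodule 𝒪[K] (Fin 3 → K)} (hMd : M ≤ dualLatt σ H M) (he : (Pi.single i (1 : K) : Fin 3 → K) ∈ M) (hcoord : ∀ x ∈ M, Valued.v (x i) ≤ 1)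
    (Y : Matrix (Fin 3) (Fin 3) K) {c cᵢ : K} (hc : Valued.v c ≤ 1) (hcᵢ : Valued.v cᵢ ≤ 1) (d : ℕ)
    (hYW : ∀ x ∈ M, x i = 0 → (ϖ ^ (d + 1))⁻¹ • (Y *ᵥ x - (c * ϖ ^ d) • x) ∈ M)
    (hYL : (ϖ ^ (d + 1))⁻¹ • (Y *ᵥ Pi.single i (1 : K) - (cᵢ * ϖ ^ d) • Pi.single i (1 : K)) ∈ M)
    (hunit : Valued.v ((c - cᵢ) * H i i) = 1) {ε : K} (hε : ∀ z : K, Valued.v z ≤ 1 → Valued.v (z ^ 2 - ε) = 1)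
    {x : Fin 3 → K} (hx : x ∈ M) (hiso : Valued.v (pairing σ H x x) < 1) (hxi : Valued.v (x i) = 1) :
    ¬ ∃ b : K, Valued.v b = 1 ∧ Valued.v (-((ϖ ^ d)⁻¹ * pairing σ H x (Y *ᵥ x)) - (c - cᵢ) * H i i * ε * b ^ 2) < 1 := by
  rintro ⟨b, hb, h₂⟩
  obtain ⟨a, ha, h₁⟩ := v_neg_pairing_mulVec_sub_mul_sq_lt_of_block hres hϖ hϖ0 i hHcol hHii hMd he hcoord Y hc hcᵢ d hYW hYL hx hiso hxi
  exact not_v_sub_mul_sq_lt_and_v_sub_mul_mul_sq_lt hε hunit _ ha hb h₁ h₂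

/-! ## §4 The axis directions: at a line inside the plane the value vanishes residually -/

/-- **AXIS DIRECTIONS.**  Under the hypotheses of the class lock, at a line with `|x_i| < 1` (the residual point `x̄` lies IN the plane `M̄′`, an isotropic point of the binary
part — DESIGN §2's `ν(L)` directions): `|ϖ^{−d}⟨x, Yx⟩| < 1` — the depth-`d` value vanishes residually (the corner passes; these children do not carry the locked class).
[cite: Kottwitz1986, §3] [cite: Rogawski1990, §4.9 pp. 54–56] -/
theorem v_pairing_mulVec_lt_one_of_block {σ : K →+* K} (hres : ∀ z : K, Valued.v z ≤ 1 → Valued.v (σ z - z) < 1)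
    {ϖ : K} (hϖ : Valued.v ϖ < 1) (hϖ0 : ϖ ≠ 0) {H : Matrix (Fin 3) (Fin 3) K} (i : Fin 3) (hHcol : ∀ l, l ≠ i → H l i = 0) (hHii : Valued.v (H i i) ≤ 1)
    {M : Submodule 𝒪[K] (Fin 3 → K)} (hMd : M ≤ dualLatt σ H M) (he : (Pi.single i (1 : K) : Fin 3 → K) ∈ M) (hcoord : ∀ x ∈ M, Valued.v (x i) ≤ 1)
    (Y : Matrix (Fin 3) (Fin 3) K) {c cᵢ : K} (hc : Valued.v c ≤ 1) (hcᵢ : Valued.v cᵢ ≤ 1) (d : ℕ)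
    (hYW : ∀ x ∈ M, x i = 0 → (ϖ ^ (d + 1))⁻¹ • (Y *ᵥ x - (c * ϖ ^ d) • x) ∈ M)
    (hYL : (ϖ ^ (d + 1))⁻¹ • (Y *ᵥ Pi.single i (1 : K) - (cᵢ * ϖ ^ d) • Pi.single i (1 : K)) ∈ M)
    {x : Fin 3 → K} (hx : x ∈ M) (hiso : Valued.v (pairing σ H x x) < 1) (hxi : Valued.v (x i) < 1) :
    Valued.v ((ϖ ^ d)⁻¹ * pairing σ H x (Y *ᵥ x)) < 1 := by
  have h := v_pairing_mulVec_sub_mul_sq_lt_of_block hres hϖ hϖ0 i hHcol hHii hMd he hcoord Y hc hcᵢ d hYW hYL hx hiso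
  have hcc : Valued.v (cᵢ - c) ≤ 1 := (Valuation.map_sub _ _ _).trans (max_le hcᵢ hc)
  have hsq : Valued.v ((cᵢ - c) * H i i * x i ^ 2) < 1 := by
    have hx2 : Valued.v (x i ^ 2) < 1 := by
      rw [pow_two, map_mul]; exact (mul_le_of_le_one_left' hxi.le).trans_lt hxi
    rw [map_mul, map_mul]
    exact (mul_le_of_le_one_left' (mul_le_one' hcc hHii)).trans_lt hx2
  have e : (ϖ ^ d)⁻¹ * pairing σ H x (Y *ᵥ x) = ((ϖ ^ d)⁻¹ * pairing σ H x (Y *ᵥ x) - (cᵢ - c) * H i i * x i ^ 2) + (cᵢ - c) * H i i * x i ^ 2 := by ring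
  rw [e]
  exact Valuation.map_add_lt _ h hsq

/-! ## §5 Across the literal family: the constant twists with the line entry of the form (`s_b = s₀·κ_b`) -/

/-- **THE κ-LOCK.**  If the line entry of the form is `ε`-twisted, `H_{ii} = ε·h` (the literals with `b_u = 1`: `d_b,u = ε·d⁰_u`), then under the hypotheses of the class lock
the class constant is `ε`-twisted: at a line with `|x_i| = 1`, `∃ a, |a| = 1 ∧ |−ϖ^{−d}⟨x, Yx⟩ − ((c − cᵢ)·h)·ε·a²| < 1` — i.e. the value lies in the class `CLS((c − cᵢ)h·ε)`,
the OTHER class than the untwisted literal's `CLS((c − cᵢ)h)` (§3): `s_b = s₀·κ_b`, `κ_b = (−1)^{b_u}`. [cite: Rogawski1990, §4.9 pp. 54–56] [cite: Kottwitz1986, §3] -/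
theorem v_neg_pairing_mulVec_sub_mul_mul_sq_lt_of_block {σ : K →+* K} (hres : ∀ z : K, Valued.v z ≤ 1 → Valued.v (σ z - z) < 1)
    {ϖ : K} (hϖ : Valued.v ϖ < 1) (hϖ0 : ϖ ≠ 0) {H : Matrix (Fin 3) (Fin 3) K} (i : Fin 3) (hHcol : ∀ l, l ≠ i → H l i = 0)
    {h ε : K} (hHii : H i i = ε * h) (hh : Valued.v h ≤ 1) (hε1 : Valued.v ε ≤ 1)
    {M : Submodule 𝒪[K] (Fin 3 → K)} (hMd : M ≤ dualLatt σ H M) (he : (Pi.single i (1 : K) : Fin 3 → K) ∈ M) (hcoord : ∀ x ∈ M, Valued.v (x i) ≤ 1)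
    (Y : Matrix (Fin 3) (Fin 3) K) {c cᵢ : K} (hc : Valued.v c ≤ 1) (hcᵢ : Valued.v cᵢ ≤ 1) (d : ℕ)
    (hYW : ∀ x ∈ M, x i = 0 → (ϖ ^ (d + 1))⁻¹ • (Y *ᵥ x - (c * ϖ ^ d) • x) ∈ M)
    (hYL : (ϖ ^ (d + 1))⁻¹ • (Y *ᵥ Pi.single i (1 : K) - (cᵢ * ϖ ^ d) • Pi.single i (1 : K)) ∈ M)
    {x : Fin 3 → K} (hx : x ∈ M) (hiso : Valued.v (pairing σ H x x) < 1) (hxi : Valued.v (x i) = 1) :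
    ∃ a : K, Valued.v a = 1 ∧ Valued.v (-((ϖ ^ d)⁻¹ * pairing σ H x (Y *ᵥ x)) - (c - cᵢ) * h * ε * a ^ 2) < 1 := by
  have hHii' : Valued.v (H i i) ≤ 1 := by rw [hHii, map_mul]; exact mul_le_one' hε1 hh
  obtain ⟨a, ha, hlt⟩ := v_neg_pairing_mulVec_sub_mul_sq_lt_of_block hres hϖ hϖ0 i hHcol hHii' hMd he hcoord Y hc hcᵢ d hYW hYL hx hiso hxi
  refine ⟨a, ha, ?_⟩
  rw [hHii] at hlt
  convert hlt using 2
  ring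

/-! ## §6 The diagonal model: an interior axis vertex of an isoceles type-(1) literal -/

omit [Valued K ℤᵐ⁰] in
/-- Three pairwise constraints `j ≠ i`, `j′ ≠ i`, `j ≠ j′` in `Fin 3` exhaust the indices. [cite: Serre1980Trees, II.1.1] -/
private theorem fin_three_cover (i j j' : Fin 3) (hj : j ≠ i) (hj' : j' ≠ i) (hjj' : j ≠ j') (l : Fin 3) : l = i ∨ l = j ∨ l = j' := by
  revert i j j' l; decide

/-- **THE DIAGONAL MODEL (interior axis vertex).**  `H = diag(h)` with `|h_l| ≤ 1`; `Y = ϖ^d·diag(s)` with `|s_l| ≤ 1` and the two residues off the isolated index `i`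
congruent: for `j ≠ i`, `j′ ≠ i` the remainder `ϖ⁻¹(s_j − s_{j′})·x_j·e_j` lies in `M` for every `x ∈ M ∩ W_i` (automatic for `j = j′`; for `j ≠ j′` it is the INTERIOR condition of
the binary fixed ball, DESIGN §2); `M ≤ M^♯`, `e_i ∈ M`, `|x_i| ≤ 1` on `M` (★ `v_apply_le_one_and_single_mem_of_isolated`).  Then for every `x ∈ M` with `|⟨x, x⟩| < 1`:
**`|ϖ^{−d}⟨x, Yx⟩ − (s_i − s_{j′})·h_i·x_i²| < 1`** — at the isoceles literal `t = diag(λ)` (`S = ϖ^{−d₀}(t − 1) = diag(s)`, residues `(2Ā, 0, 2Ā)` after DESIGN's translation)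
this is `−Q_Ȳ(x̄) ≡ 2Ā·d̄_u·x̄_u²`. [cite: Kottwitz1986, §3] [cite: Rogawski1990, §4.9 pp. 54–56] [cite: BruhatTits1972, §10] -/
theorem v_pairing_diagonal_mulVec_sub_mul_sq_lt_of_interior {σ : K →+* K} (hres : ∀ z : K, Valued.v z ≤ 1 → Valued.v (σ z - z) < 1)
    {ϖ : K} (hϖ : Valued.v ϖ < 1) (hϖ0 : ϖ ≠ 0) {h : Fin 3 → K} (hh : ∀ l, Valued.v (h l) ≤ 1) (i j j' : Fin 3) (hj : j ≠ i) (hj' : j' ≠ i) (hjj' : j ≠ j')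
    {s : Fin 3 → K} (hs : ∀ l, Valued.v (s l) ≤ 1) (d : ℕ)
    {M : Submodule 𝒪[K] (Fin 3 → K)} (hMd : M ≤ dualLatt σ (Matrix.diagonal h) M) (he : (Pi.single i (1 : K) : Fin 3 → K) ∈ M)
    (hcoord : ∀ x ∈ M, Valued.v (x i) ≤ 1)
    (hinner : ∀ x ∈ M, x i = 0 → (Pi.single j (ϖ⁻¹ * (s j - s j') * x j) : Fin 3 → K) ∈ M)
    {x : Fin 3 → K} (hx : x ∈ M) (hiso : Valued.v (pairing σ (Matrix.diagonal h) x x) < 1) :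
    Valued.v ((ϖ ^ d)⁻¹ * pairing σ (Matrix.diagonal h) x ((ϖ ^ d • Matrix.diagonal s) *ᵥ x) - (s i - s j') * h i * x i ^ 2) < 1 := by
  have hHcol : ∀ l, l ≠ i → Matrix.diagonal h l i = 0 := fun l hl => Matrix.diagonal_apply_ne _ hl
  have hHii : Valued.v (Matrix.diagonal h i i) ≤ 1 := by rw [Matrix.diagonal_apply_eq]; exact hh i
  have hcover : ∀ l, l = i ∨ l = j ∨ l = j' := fin_three_cover i j j' hj hj' hjj'
  -- (L): exact, remainder `0`
  have hYL : (ϖ ^ (d + 1))⁻¹ • ((ϖ ^ d • Matrix.diagonal s) *ᵥ Pi.single i (1 : K) - (s i * ϖ ^ d) • Pi.single i (1 : K)) ∈ M := by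
    have e0 : (ϖ ^ d • Matrix.diagonal s) *ᵥ Pi.single i (1 : K) - (s i * ϖ ^ d) • Pi.single i (1 : K) = 0 := by
      ext l
      simp only [Pi.sub_apply, Matrix.smul_mulVec, Pi.smul_apply, Matrix.mulVec_diagonal, smul_eq_mul, Pi.zero_apply]
      by_cases hl : l = i
      · subst hl; rw [Pi.single_eq_same]; ring
      · rw [Pi.single_eq_of_ne hl]; ring
    rw [e0, smul_zero]; exact M.zero_mem
  -- (W): the remainder is `ϖ⁻¹(s_j − s_{j′}) x_j e_j`
  have hYW : ∀ x ∈ M, x i = 0 → (ϖ ^ (d + 1))⁻¹ • ((ϖ ^ d • Matrix.diagonal s) *ᵥ x - (s j' * ϖ ^ d) • x) ∈ M := by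
    intro y hy hyi
    have e1 : (ϖ ^ (d + 1))⁻¹ • ((ϖ ^ d • Matrix.diagonal s) *ᵥ y - (s j' * ϖ ^ d) • y) = Pi.single j (ϖ⁻¹ * (s j - s j') * y j) := by
      ext l
      simp only [Pi.smul_apply, Pi.sub_apply, Matrix.smul_mulVec, Matrix.mulVec_diagonal, smul_eq_mul]
      rcases hcover l with rfl | rfl | rfl
      · rw [hyi, Pi.single_eq_of_ne (Ne.symm hj)]; ring
      · rw [Pi.single_eq_same, pow_succ]; field_simp
      · rw [Pi.single_eq_of_ne (Ne.symm hjj')]; ring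
    rw [e1]; exact hinner y hy hyi
  have hmain := v_pairing_mulVec_sub_mul_sq_lt_of_block hres hϖ hϖ0 i hHcol hHii hMd he hcoord (ϖ ^ d • Matrix.diagonal s) (hs j') (hs i) d hYW hYL hx hiso
  rwa [Matrix.diagonal_apply_eq] at hmain

/-! ## §7 Exact block additivity of the value (ED. 2) -/

omit [Valued K ℤᵐ⁰] in
/-- **BLOCK ADDITIVITY.**  If BOTH the form `H` and the matrix `Y` are block at `i` (`H_{li} = H_{il} = 0`, `Y_{li} = Y_{il} = 0` for `l ≠ i`), then for every `x`, with
`x′ = x − x_i e_i`: `⟨x, Yx⟩_H = σ(x_i)·H_{ii}·(Y_{ii}·x_i) + ⟨x′, Yx′⟩_H` — the value splits EXACTLY into the line value and the BINARY value of the plane part (pure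
algebra; every axis vertex, interior or end). [cite: BruhatTits1972, §10] [cite: Kottwitz1986, §3] -/
theorem pairing_mulVec_eq_add_of_block {N : ℕ} (σ : K →+* K) (H : Matrix (Fin N) (Fin N) K) (i : Fin N)
    (hHcol : ∀ l, l ≠ i → H l i = 0) (hHrow : ∀ l, l ≠ i → H i l = 0)
    (Y : Matrix (Fin N) (Fin N) K) (hYcol : ∀ l, l ≠ i → Y l i = 0) (hYrow : ∀ l, l ≠ i → Y i l = 0) (x : Fin N → K) :
    pairing σ H x (Y *ᵥ x) = σ (x i) * H i i * (Y i i * x i) + pairing σ H (x - Pi.single i (x i)) (Y *ᵥ (x - Pi.single i (x i))) := by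
  have hx'i : (x - Pi.single i (x i) : Fin N → K) i = 0 := by simp
  have hYx'i : (Y *ᵥ (x - Pi.single i (x i))) i = 0 := mulVec_apply_eq_zero_of_row_eq Y i hYrow hx'i
  have e : x = (x - Pi.single i (x i)) + Pi.single i (x i) := (sub_add_cancel _ _).symm
  conv_lhs => rw [e]
  rw [Matrix.mulVec_add, mulVec_single_of_col_eq Y i hYcol, LinearMap.map_add₂, map_add, map_add,
    pairing_single_right_of_block σ H i hHcol, hx'i, map_zero, zero_mul, zero_mul, add_zero,
    pairing_single_left_of_block σ H i hHrow, hYx'i, mul_zero, zero_add, pairing_single_left_of_block σ H i hHrow, Pi.single_eq_same]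
  ring

/-! ## §8 A rank-one remainder on the plane: the END axis vertex (ED. 2) -/

omit [Valued K ℤᵐ⁰] in
/-- **THE FIRST-ORDER IDENTITY WITH A RANK-ONE REMAINDER.**  If `Y x′ = c ϖ^d x′ + (λϖ^d⟨v, x′⟩)·v + ϖ^{d+1} m₂` (`x′ = x − x_i e_i`, `v_i = 0`) and
`Y e_i = cᵢ ϖ^d e_i + ϖ^{d+1} m₁`, then for a form block at `i`:
`⟨x, Yx⟩ = ϖ^d·((cᵢ − c)·H_{ii}·σ(x_i)x_i + c·⟨x, x⟩ + λ·⟨v, x⟩·⟨x, v⟩) + ϖ^{d+1}·(⟨x, m₂⟩ + x_i·⟨x, m₁⟩)` (pure algebra; `⟨v, x′⟩ = ⟨v, x⟩`, `⟨x, v⟩` untouched since `e_i ⊥ v`).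
[cite: Kottwitz1986, §3] [cite: BruhatTits1972, §10] -/
theorem pairing_mulVec_eq_of_block_of_rankOne (σ : K →+* K) (H : Matrix (Fin 3) (Fin 3) K) (i : Fin 3) (hHcol : ∀ l, l ≠ i → H l i = 0)
    (Y : Matrix (Fin 3) (Fin 3) K) (ϖ c cᵢ lam : K) (d : ℕ) {v : Fin 3 → K} (hvi : v i = 0) {x m₁ m₂ : Fin 3 → K}
    (hW : Y *ᵥ (x - Pi.single i (x i)) = (c * ϖ ^ d) • (x - Pi.single i (x i)) + (lam * ϖ ^ d * pairing σ H v (x - Pi.single i (x i))) • v + ϖ ^ (d + 1) • m₂)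
    (hL : Y *ᵥ Pi.single i (1 : K) = (cᵢ * ϖ ^ d) • Pi.single i (1 : K) + ϖ ^ (d + 1) • m₁) :
    pairing σ H x (Y *ᵥ x) = ϖ ^ d * ((cᵢ - c) * H i i * (σ (x i) * x i) + c * pairing σ H x x + lam * pairing σ H v x * pairing σ H x v) +
      ϖ ^ (d + 1) * (pairing σ H x m₂ + x i * pairing σ H x m₁) := by
  have hsingle : (Pi.single i (x i) : Fin 3 → K) = x i • (Pi.single i (1 : K) : Fin 3 → K) := by
    ext l; by_cases hl : l = i
    · subst hl; simp
    · simp [Pi.single_eq_of_ne hl]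
  have hvx : pairing σ H v (x - Pi.single i (x i)) = pairing σ H v x := by
    rw [map_sub, pairing_single_right_of_block σ H i hHcol, hvi, map_zero, zero_mul, zero_mul, sub_zero]
  have e : x = (x - Pi.single i (x i)) + x i • (Pi.single i (1 : K) : Fin 3 → K) := by rw [← hsingle, sub_add_cancel]
  have hYx : Y *ᵥ x = ((c * ϖ ^ d) • (x - Pi.single i (x i)) + (lam * ϖ ^ d * pairing σ H v x) • v + ϖ ^ (d + 1) • m₂) +
      x i • ((cᵢ * ϖ ^ d) • Pi.single i (1 : K) + ϖ ^ (d + 1) • m₁) := by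
    conv_lhs => rw [e]
    rw [Matrix.mulVec_add, Matrix.mulVec_smul, hW, hL, hvx]
  rw [hYx, map_add, map_add, map_add, map_smul, map_smul, map_smul, map_smul, map_add, map_smul, map_smul, pairing_self_sub_single_eq_of_block σ H i hHcol,
    pairing_single_right_of_block σ H i hHcol]
  simp only [smul_eq_mul]
  ring

/-- **THE VALUE LAW AT AN END AXIS VERTEX (rank-one remainder).**  As in the class lock (§2), but on the plane part `Y` is the scalar `cϖ^d` PLUS a rank-one term:
(W′) `ϖ^{−(d+1)}·(Y x′ − cϖ^d x′ − λϖ^d⟨v, x′⟩·v) ∈ M` for `x′ ∈ M ∩ W_i`, with `v ∈ M ∩ W_i` and `λ` integral (the END vertex of ★ p847254: the `W`-block of the leading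
term is the rank-one self-adjoint `λ·v̄v̄^†`, `v̄` the inward line).  Then for every `x ∈ M` with `|⟨x, x⟩| < 1`:
**`|ϖ^{−d}⟨x, Yx⟩ − ((cᵢ − c)·H_{ii}·x_i² + λ·⟨v, x⟩·⟨x, v⟩)| < 1`** — the lattice half of `Q_END = e·x_u² + λ·ℓ_in²` (`ℓ_in = ⟨v̄, ·⟩`).
[cite: Kottwitz1986, §3] [cite: Rogawski1990, §4.9 pp. 54–56] [cite: BruhatTits1972, §10] -/
theorem v_pairing_mulVec_sub_lt_of_block_of_rankOne {σ : K →+* K} (hres : ∀ z : K, Valued.v z ≤ 1 → Valued.v (σ z - z) < 1)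
    {ϖ : K} (hϖ : Valued.v ϖ < 1) (hϖ0 : ϖ ≠ 0) {H : Matrix (Fin 3) (Fin 3) K} (i : Fin 3) (hHcol : ∀ l, l ≠ i → H l i = 0) (hHii : Valued.v (H i i) ≤ 1)
    {M : Submodule 𝒪[K] (Fin 3 → K)} (hMd : M ≤ dualLatt σ H M) (he : (Pi.single i (1 : K) : Fin 3 → K) ∈ M) (hcoord : ∀ x ∈ M, Valued.v (x i) ≤ 1)
    (Y : Matrix (Fin 3) (Fin 3) K) {c cᵢ lam : K} (hc : Valued.v c ≤ 1) (hcᵢ : Valued.v cᵢ ≤ 1) (d : ℕ) {v : Fin 3 → K} (hvi : v i = 0)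
    (hYW : ∀ x ∈ M, x i = 0 → (ϖ ^ (d + 1))⁻¹ • (Y *ᵥ x - (c * ϖ ^ d) • x - (lam * ϖ ^ d * pairing σ H v x) • v) ∈ M)
    (hYL : (ϖ ^ (d + 1))⁻¹ • (Y *ᵥ Pi.single i (1 : K) - (cᵢ * ϖ ^ d) • Pi.single i (1 : K)) ∈ M)
    {x : Fin 3 → K} (hx : x ∈ M) (hiso : Valued.v (pairing σ H x x) < 1) :
    Valued.v ((ϖ ^ d)⁻¹ * pairing σ H x (Y *ᵥ x) - ((cᵢ - c) * H i i * x i ^ 2 + lam * pairing σ H v x * pairing σ H x v)) < 1 := by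
  have hϖd1 : ϖ ^ (d + 1) ≠ 0 := pow_ne_zero _ hϖ0
  -- the split `x = x_i e_i + x′`, `x′ ∈ M ∩ W_i`
  have hsingle : (Pi.single i (x i) : Fin 3 → K) = (⟨x i, (mem_integer_iff' _).2 (hcoord x hx)⟩ : 𝒪[K]) • (Pi.single i (1 : K) : Fin 3 → K) := by
    ext l
    change (Pi.single i (x i) : Fin 3 → K) l = x i * (Pi.single i (1 : K) : Fin 3 → K) l
    by_cases hl : l = i
    · subst hl; simp
    · simp [Pi.single_eq_of_ne hl]
  have hx' : x - Pi.single i (x i) ∈ M := M.sub_mem hx (by rw [hsingle]; exact M.smul_mem _ he)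
  have hx'i : (x - Pi.single i (x i) : Fin 3 → K) i = 0 := by simp
  set m₂ := (ϖ ^ (d + 1))⁻¹ • (Y *ᵥ (x - Pi.single i (x i)) - (c * ϖ ^ d) • (x - Pi.single i (x i)) -
    (lam * ϖ ^ d * pairing σ H v (x - Pi.single i (x i))) • v) with hm₂
  set m₁ := (ϖ ^ (d + 1))⁻¹ • (Y *ᵥ Pi.single i (1 : K) - (cᵢ * ϖ ^ d) • Pi.single i (1 : K)) with hm₁
  have hm₂M : m₂ ∈ M := hYW _ hx' hx'i
  have hm₁M : m₁ ∈ M := hYL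
  have hW : Y *ᵥ (x - Pi.single i (x i)) = (c * ϖ ^ d) • (x - Pi.single i (x i)) + (lam * ϖ ^ d * pairing σ H v (x - Pi.single i (x i))) • v + ϖ ^ (d + 1) • m₂ := by
    rw [hm₂, smul_smul, mul_inv_cancel₀ hϖd1, one_smul, sub_sub, add_sub_cancel]
  have hL : Y *ᵥ Pi.single i (1 : K) = (cᵢ * ϖ ^ d) • Pi.single i (1 : K) + ϖ ^ (d + 1) • m₁ := by
    rw [hm₁, smul_smul, mul_inv_cancel₀ hϖd1, one_smul, add_sub_cancel]
  have hkey : (ϖ ^ d)⁻¹ * pairing σ H x (Y *ᵥ x) - ((cᵢ - c) * H i i * x i ^ 2 + lam * pairing σ H v x * pairing σ H x v) =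
      (cᵢ - c) * H i i * x i * (σ (x i) - x i) + c * pairing σ H x x + ϖ * (pairing σ H x m₂ + x i * pairing σ H x m₁) := by
    rw [pairing_mulVec_eq_of_block_of_rankOne σ H i hHcol Y ϖ c cᵢ lam d hvi hW hL, pow_succ]
    field_simp
    ring
  rw [hkey]
  have hxi := hcoord x hx
  have hcc : Valued.v (cᵢ - c) ≤ 1 := (Valuation.map_sub _ _ _).trans (max_le hcᵢ hc)
  have h1 : Valued.v ((cᵢ - c) * H i i * x i * (σ (x i) - x i)) < 1 := by
    rw [map_mul, map_mul, map_mul]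
    exact (mul_le_of_le_one_left' (mul_le_one' (mul_le_one' hcc hHii) hxi)).trans_lt (hres _ hxi)
  have h2 : Valued.v (c * pairing σ H x x) < 1 := by
    rw [map_mul]; exact (mul_le_of_le_one_left' hc).trans_lt hiso
  have h3 : Valued.v (ϖ * (pairing σ H x m₂ + x i * pairing σ H x m₁)) < 1 := by
    have hint : Valued.v (pairing σ H x m₂ + x i * pairing σ H x m₁) ≤ 1 := by
      refine (Valuation.map_add _ _ _).trans (max_le ?_ ?_)
      · exact (mem_dualLatt σ H M _).1 (hMd hm₂M) x hx
      · rw [map_mul]; exact mul_le_one' hxi ((mem_dualLatt σ H M _).1 (hMd hm₁M) x hx)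
    rw [map_mul]
    exact (mul_le_of_le_one_right' hint).trans_lt hϖ
  exact Valuation.map_add_lt _ (Valuation.map_add_lt _ h1 h2) h3

/-- **HERMITIAN READING: `λ·|⟨v, x⟩|² ≡ λ·⟨v, x⟩²`.**  If moreover the pairing is hermitian (`σ⟨y, z⟩ = ⟨z, y⟩` — ★ `σ_pairing_eq` for `σ` an involution and
`(H.map σ)ᵀ = H`), then `⟨x, v⟩ = σ⟨v, x⟩`, and since `σ` is residually trivial on the integral value `⟨v, x⟩` (`v, x ∈ M ≤ M^♯`):
**`|ϖ^{−d}⟨x, Yx⟩ − ((cᵢ − c)·H_{ii}·x_i² + λ·⟨v, x⟩²)| < 1`** — p847254's `Q_END = e·x_u² + λ·ℓ_in(x̄)²` on the lattice. [cite: Rogawski1990, §4.9 pp. 54–56] [cite: Kottwitz1986, §3] -/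
theorem v_pairing_mulVec_sub_sq_lt_of_block_of_rankOne {σ : K →+* K} (hres : ∀ z : K, Valued.v z ≤ 1 → Valued.v (σ z - z) < 1)
    {ϖ : K} (hϖ : Valued.v ϖ < 1) (hϖ0 : ϖ ≠ 0) {H : Matrix (Fin 3) (Fin 3) K} (hH : ∀ y z : Fin 3 → K, σ (pairing σ H y z) = pairing σ H z y) (i : Fin 3)
    (hHcol : ∀ l, l ≠ i → H l i = 0) (hHii : Valued.v (H i i) ≤ 1)
    {M : Submodule 𝒪[K] (Fin 3 → K)} (hMd : M ≤ dualLatt σ H M) (he : (Pi.single i (1 : K) : Fin 3 → K) ∈ M) (hcoord : ∀ x ∈ M, Valued.v (x i) ≤ 1)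
    (Y : Matrix (Fin 3) (Fin 3) K) {c cᵢ lam : K} (hc : Valued.v c ≤ 1) (hcᵢ : Valued.v cᵢ ≤ 1) (hlam : Valued.v lam ≤ 1) (d : ℕ) {v : Fin 3 → K} (hv : v ∈ M)
    (hvi : v i = 0)
    (hYW : ∀ x ∈ M, x i = 0 → (ϖ ^ (d + 1))⁻¹ • (Y *ᵥ x - (c * ϖ ^ d) • x - (lam * ϖ ^ d * pairing σ H v x) • v) ∈ M)
    (hYL : (ϖ ^ (d + 1))⁻¹ • (Y *ᵥ Pi.single i (1 : K) - (cᵢ * ϖ ^ d) • Pi.single i (1 : K)) ∈ M)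
    {x : Fin 3 → K} (hx : x ∈ M) (hiso : Valued.v (pairing σ H x x) < 1) :
    Valued.v ((ϖ ^ d)⁻¹ * pairing σ H x (Y *ᵥ x) - ((cᵢ - c) * H i i * x i ^ 2 + lam * pairing σ H v x ^ 2)) < 1 := by
  have h := v_pairing_mulVec_sub_lt_of_block_of_rankOne hres hϖ hϖ0 i hHcol hHii hMd he hcoord Y hc hcᵢ d hvi hYW hYL hx hiso
  have hxv : pairing σ H x v = σ (pairing σ H v x) := (hH v x).symm
  have hint : Valued.v (pairing σ H v x) ≤ 1 := (mem_dualLatt σ H M _).1 (hMd hx) v hv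
  -- the correction `λ·⟨v,x⟩·(σ⟨v,x⟩ − ⟨v,x⟩)` is in `𝔪`
  have hcorr : Valued.v (lam * pairing σ H v x * (σ (pairing σ H v x) - pairing σ H v x)) < 1 := by
    rw [map_mul, map_mul]
    exact (mul_le_of_le_one_left' (mul_le_one' hlam hint)).trans_lt (hres _ hint)
  have e : (ϖ ^ d)⁻¹ * pairing σ H x (Y *ᵥ x) - ((cᵢ - c) * H i i * x i ^ 2 + lam * pairing σ H v x ^ 2) =
      ((ϖ ^ d)⁻¹ * pairing σ H x (Y *ᵥ x) - ((cᵢ - c) * H i i * x i ^ 2 + lam * pairing σ H v x * pairing σ H x v)) +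
        lam * pairing σ H v x * (σ (pairing σ H v x) - pairing σ H v x) := by
    rw [hxv]; ring
  rw [e]
  exact Valuation.map_add_lt _ h hcorr

end Literature.NumberTheory.Automorphic.UnitaryLatticeTree

end
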